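import Literature.AlgebraicGeometry.HodgeTheory.NoTypeIVFactorProducts
import Literature.AlgebraicGeometry.Milne1999.CMTypeSubquotients
import Literature.AlgebraicGeometry.Motives.AbelianVarietyIsogenousProductOfSimples
import Literature.AlgebraicGeometry.Motives.AbelianVarietyIsogenyCancellation
import Literature.AlgebraicGeometry.Motives.AbelianVarietyProductIsogeny
import HarnessLib

/-!
# Grouping the factors: a product of abelian varieties each WITHOUT factor of type IV or OF CM TYPE is, up to isogeny,
# `Y × Z` with `Y` without factor of type IV and `Z` of CM type (or has no factor of type IV, or is of CM type)

Family `hodge`, layer `Literature/AlgebraicGeometry/HodgeTheory`; THEOREMS ONLY (no definition, no named fact).  Written for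
the cell `pub-hodgecm2` (COR-CM), seat `b27` gen 43 (count-neutral Mumford–Tate-rank ladder), as the geometric input of
the product formula `dim Lie Hg(H¹(Y × Z)) = dim Lie Hg(H¹Y) + dim Lie Hg(H¹Z)` (`Y` without factor of type IV, `Z` of CM type;
`Motives/HodgeLieOfAbelianVarietySemisimpleTimesCM`, `CorCM/MumfordTateRankSemisimpleTimesCM`): every complex abelian variety
whose simple factors are each WITHOUT FACTOR OF TYPE IV (centre of `End⁰` totally real) or OF CM TYPE regroups, up to isogeny,
as such a product.  This is the grouping step of Moonen–Zarhin's proof of their Thm. (0.2) («Write `X₁ ⊆ X` for the maximal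
abelian subvariety which has no factors of Type 4, and `X₂ ⊆ X` for the maximal abelian subvariety of which all factors are of
Type 4», Math. Ann. 315 (1999) §7 [corpus: paper:arxiv-math_9901113 p. 9]) in the case where the type-IV factors are of CM type,
on top of Poincaré's complete reducibility (`X` is isogenous to a product of simple abelian varieties, Milne §12 Prop. 12.1;
the tree's `exists_productOf_simple_isIsogenous`, `IsProductOf`).

* §1 `isIsogenous_prod_comm`, `isIsogenous_prod_assoc` — `A × B ∼ B × A`, `(A × B) × C ∼ A × (B × C)` (`AbelianVariety.prod`;
  through `⊞` / `⨯` and Mathlib's associator).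
* §2 **`hasNoTypeIVFactor_or_isOfCMType_or_exists_isIsogenous_prod`** — for `P` a finite product (`IsProductOf`) of abelian
  varieties each without factor of type IV or of CM type: `P` has no factor of type IV, OR `P` is of CM type, OR
  `P ∼ Y × Z` with `Y` without factor of type IV, `Z` of CM type (`…_pos`: with `0 < dim Y`, `0 < dim Z` when all blocks have
  positive dimension); §3 the same for every `X` isogenous to such a `P`.

## References
* [MoonenZarhin1999LowDim] B. Moonen, Yu. Zarhin, *Hodge classes on abelian varieties of low dimension*, Math. Ann. 315
  (1999), §7 (the subvarieties `X₁`, `X₂`) and §3 Thm. (3.2)(2) [corpus: paper:arxiv-math_9901113 pp. 6, 9].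
  [cite: MoonenZarhin1999LowDim, §7 (proof of Thm. (0.2)) and §3 Thm. (3.2)(2)]
* [Milne1986AbelianVarieties] J. S. Milne, *Abelian Varieties* (Cornell–Silverman 1986), §12 Prop. 12.1 and p. 122.
  [cite: Milne1986AbelianVarieties, §12 Prop. 12.1 and p. 122]
* [MumfordAV1970] D. Mumford, *Abelian Varieties* (1970), §19 Thm. 1 and Cor. 1 (pp. 173–174).
  [cite: MumfordAV1970, §19 Thm. 1, Cor. 1–2 (pp. 173–174)]
-/

noncomputable section

open CategoryTheory CategoryTheory.Limits

namespace Literature.AlgebraicGeometry.HodgeTheory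

open Literature.AlgebraicGeometry.Motives
open Literature.AlgebraicGeometry.Motives.AbelianVariety
open Literature.AlgebraicGeometry.Milne1999

/-! ### §1 Products up to isogeny: commutativity and associativity -/

section ProdIsogeny

/-- **`A × B ∼ B × A`** (`AbelianVariety.prod`; through the biproduct `A ⊞ B ≅ A × B` and `A ⊞ B ∼ B ⊞ A`).
[cite: Milne1986AbelianVarieties, §12 Prop. 12.1 and p. 122] -/
theorem isIsogenous_prod_comm (A B : AbelianVariety ℂ) : IsIsogenous (A.prod B) (B.prod A) :=
  (IsIsogenous.trans ⟨(biprodIsoProd A B).inv, isIsogeny_hom_of_iso (biprodIsoProd A B).symm⟩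
    (isIsogenous_biprod_comm A B)).trans ⟨(biprodIsoProd B A).hom, isIsogeny_hom_of_iso (biprodIsoProd B A)⟩

/-- **`(A × B) × C ∼ A × (B × C)`** (indeed isomorphic: Mathlib's associator of binary products, transported along
`A ⨯ B ≅ A.prod B`). [cite: Milne1986AbelianVarieties, §12 Prop. 12.1 and p. 122] -/
theorem isIsogenous_prod_assoc (A B C : AbelianVariety ℂ) : IsIsogenous ((A.prod B).prod C) (A.prod (B.prod C)) := by
  let e : (A.prod B).prod C ≅ A.prod (B.prod C) :=
    (prodIsoProd (A.prod B) C).symm ≪≫ prod.mapIso (prodIsoProd A B).symm (Iso.refl C) ≪≫ prod.associator A B C ≪≫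
      prod.mapIso (Iso.refl A) (prodIsoProd B C) ≪≫ prodIsoProd A (B.prod C)
  exact ⟨e.hom, isIsogeny_hom_of_iso e⟩

end ProdIsogeny

/-! ### §2 Grouping the factors of a finite product -/

/-- **Grouping: a finite product of complex abelian varieties each without factor of type IV or of CM type has no factor of
type IV, or is of CM type, or is isogenous to `Y × Z` with `Y` without factor of type IV and `Z` of CM type.**  Induction on
`IsProductOf`: `no-IV × no-IV` is no-IV (`HasNoTypeIVFactor.prod`), `CM × CM` is CM (`IsOfCMType.prod`), and the mixed cases
regroup by commutativity / associativity of `×` up to isogeny. [cite: MoonenZarhin1999LowDim, §7 (proof of Thm. (0.2)) and §3 Thm. (3.2)(2)]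
[cite: Milne1986AbelianVarieties, §12 Prop. 12.1 and p. 122] -/
theorem hasNoTypeIVFactor_or_isOfCMType_or_exists_isIsogenous_prod {P : AbelianVariety ℂ}
    (hP : IsProductOf (fun S => HasNoTypeIVFactor S ∨ IsOfCMType S) P) :
    HasNoTypeIVFactor P ∨ IsOfCMType P ∨
      ∃ Y Z : AbelianVariety ℂ, HasNoTypeIVFactor Y ∧ IsOfCMType Z ∧ IsIsogenous P (Y.prod Z) := by
  induction hP with
  | atom h =>
    rcases h with h | h
    · exact Or.inl h
    · exact Or.inr (Or.inl h)
  | @prod A B _ _ ihA ihB =>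
    rcases ihA with hA | hA | ⟨Y₁, Z₁, hY₁, hZ₁, hA⟩ <;> rcases ihB with hB | hB | ⟨Y₂, Z₂, hY₂, hZ₂, hB⟩
    · -- no-IV × no-IV
      exact Or.inl (hA.prod hB)
    · -- no-IV × CM
      exact Or.inr (Or.inr ⟨A, B, hA, hB, IsIsogenous.refl _⟩)
    · -- no-IV × (Y₂ × Z₂) ∼ (A × Y₂) × Z₂
      refine Or.inr (Or.inr ⟨A.prod Y₂, Z₂, hA.prod hY₂, hZ₂, ?_⟩)
      exact ((IsIsogenous.refl A).prod hB).trans (isIsogenous_prod_assoc A Y₂ Z₂).symm'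
    · -- CM × no-IV ∼ no-IV × CM
      exact Or.inr (Or.inr ⟨B, A, hB, hA, isIsogenous_prod_comm A B⟩)
    · -- CM × CM
      exact Or.inr (Or.inl (hA.prod hB))
    · -- CM × (Y₂ × Z₂) ∼ Y₂ × (A × Z₂)
      refine Or.inr (Or.inr ⟨Y₂, A.prod Z₂, hY₂, hA.prod hZ₂, ?_⟩)
      exact (((IsIsogenous.refl A).prod hB).trans
        ((isIsogenous_prod_assoc A Y₂ Z₂).symm'.trans (((isIsogenous_prod_comm A Y₂).prod
          (IsIsogenous.refl Z₂)).trans (isIsogenous_prod_assoc Y₂ A Z₂))))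
    · -- (Y₁ × Z₁) × no-IV ∼ (Y₁ × B) × Z₁
      refine Or.inr (Or.inr ⟨Y₁.prod B, Z₁, hY₁.prod hB, hZ₁, ?_⟩)
      exact ((hA.prod (IsIsogenous.refl B)).trans
        ((isIsogenous_prod_assoc Y₁ Z₁ B).trans ((((IsIsogenous.refl Y₁).prod (isIsogenous_prod_comm Z₁ B))).trans
          (isIsogenous_prod_assoc Y₁ B Z₁).symm')))
    · -- (Y₁ × Z₁) × CM ∼ Y₁ × (Z₁ × B)
      refine Or.inr (Or.inr ⟨Y₁, Z₁.prod B, hY₁, hZ₁.prod hB, ?_⟩)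
      exact (hA.prod (IsIsogenous.refl B)).trans (isIsogenous_prod_assoc Y₁ Z₁ B)
    · -- (Y₁ × Z₁) × (Y₂ × Z₂) ∼ (Y₁ × Y₂) × (Z₁ × Z₂)
      refine Or.inr (Or.inr ⟨Y₁.prod Y₂, Z₁.prod Z₂, hY₁.prod hY₂, hZ₁.prod hZ₂, ?_⟩)
      refine (hA.prod hB).trans ?_
      -- `(Y₁ × Z₁) × (Y₂ × Z₂) ∼ Y₁ × (Z₁ × (Y₂ × Z₂)) ∼ Y₁ × ((Z₁ × Y₂) × Z₂) ∼ Y₁ × ((Y₂ × Z₁) × Z₂)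
      --   ∼ Y₁ × (Y₂ × (Z₁ × Z₂)) ∼ (Y₁ × Y₂) × (Z₁ × Z₂)`
      exact (isIsogenous_prod_assoc Y₁ Z₁ (Y₂.prod Z₂)).trans
        ((((IsIsogenous.refl Y₁).prod
          ((isIsogenous_prod_assoc Z₁ Y₂ Z₂).symm'.trans
            ((((isIsogenous_prod_comm Z₁ Y₂).prod (IsIsogenous.refl Z₂))).trans
              (isIsogenous_prod_assoc Y₂ Z₁ Z₂))))).trans
          (isIsogenous_prod_assoc Y₁ Y₂ (Z₁.prod Z₂)).symm')

/-- **The same grouping with positive dimensions**: if every block has positive dimension then so do `P` and, in the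
mixed case, both `Y` and `Z` (`dim (A × B) = dim A + dim B`). [cite: MoonenZarhin1999LowDim, §7 (proof of Thm. (0.2)) and §3 Thm. (3.2)(2)]
[cite: Milne1986AbelianVarieties, §12 Prop. 12.1 and p. 122] -/
theorem hasNoTypeIVFactor_or_isOfCMType_or_exists_isIsogenous_prod_pos {P : AbelianVariety ℂ}
    (hP : IsProductOf (fun S => 0 < S.dim ∧ (HasNoTypeIVFactor S ∨ IsOfCMType S)) P) :
    0 < P.dim ∧ (HasNoTypeIVFactor P ∨ IsOfCMType P ∨
      ∃ Y Z : AbelianVariety ℂ, 0 < Y.dim ∧ 0 < Z.dim ∧ HasNoTypeIVFactor Y ∧ IsOfCMType Z ∧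
        IsIsogenous P (Y.prod Z)) := by
  induction hP with
  | atom h =>
    rcases h with ⟨h0, h | h⟩
    · exact ⟨h0, Or.inl h⟩
    · exact ⟨h0, Or.inr (Or.inl h)⟩
  | @prod A B _ _ ihA ihB =>
    obtain ⟨hA0, ihA⟩ := ihA
    obtain ⟨hB0, ihB⟩ := ihB
    refine ⟨by rw [dim_prod]; omega, ?_⟩
    rcases ihA with hA | hA | ⟨Y₁, Z₁, hY₁0, hZ₁0, hY₁, hZ₁, hA⟩ <;>
      rcases ihB with hB | hB | ⟨Y₂, Z₂, hY₂0, hZ₂0, hY₂, hZ₂, hB⟩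
    · exact Or.inl (hA.prod hB)
    · exact Or.inr (Or.inr ⟨A, B, hA0, hB0, hA, hB, IsIsogenous.refl _⟩)
    · refine Or.inr (Or.inr ⟨A.prod Y₂, Z₂, by rw [dim_prod]; omega, hZ₂0, hA.prod hY₂, hZ₂, ?_⟩)
      exact ((IsIsogenous.refl A).prod hB).trans (isIsogenous_prod_assoc A Y₂ Z₂).symm'
    · exact Or.inr (Or.inr ⟨B, A, hB0, hA0, hB, hA, isIsogenous_prod_comm A B⟩)
    · exact Or.inr (Or.inl (hA.prod hB))
    · refine Or.inr (Or.inr ⟨Y₂, A.prod Z₂, hY₂0, by rw [dim_prod]; omega, hY₂, hA.prod hZ₂, ?_⟩)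
      exact (((IsIsogenous.refl A).prod hB).trans
        ((isIsogenous_prod_assoc A Y₂ Z₂).symm'.trans (((isIsogenous_prod_comm A Y₂).prod
          (IsIsogenous.refl Z₂)).trans (isIsogenous_prod_assoc Y₂ A Z₂))))
    · refine Or.inr (Or.inr ⟨Y₁.prod B, Z₁, by rw [dim_prod]; omega, hZ₁0, hY₁.prod hB, hZ₁, ?_⟩)
      exact ((hA.prod (IsIsogenous.refl B)).trans
        ((isIsogenous_prod_assoc Y₁ Z₁ B).trans ((((IsIsogenous.refl Y₁).prod (isIsogenous_prod_comm Z₁ B))).trans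
          (isIsogenous_prod_assoc Y₁ B Z₁).symm')))
    · refine Or.inr (Or.inr ⟨Y₁, Z₁.prod B, hY₁0, by rw [dim_prod]; omega, hY₁, hZ₁.prod hB, ?_⟩)
      exact (hA.prod (IsIsogenous.refl B)).trans (isIsogenous_prod_assoc Y₁ Z₁ B)
    · refine Or.inr (Or.inr ⟨Y₁.prod Y₂, Z₁.prod Z₂, by rw [dim_prod]; omega, by rw [dim_prod]; omega, hY₁.prod hY₂,
        hZ₁.prod hZ₂, ?_⟩)
      refine (hA.prod hB).trans ?_
      exact (isIsogenous_prod_assoc Y₁ Z₁ (Y₂.prod Z₂)).trans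
        ((((IsIsogenous.refl Y₁).prod
          ((isIsogenous_prod_assoc Z₁ Y₂ Z₂).symm'.trans
            ((((isIsogenous_prod_comm Z₁ Y₂).prod (IsIsogenous.refl Z₂))).trans
              (isIsogenous_prod_assoc Y₂ Z₁ Z₂))))).trans
          (isIsogenous_prod_assoc Y₁ Y₂ (Z₁.prod Z₂)).symm')

/-! ### §3 Transport to isogenous varieties -/

/-- **Every complex abelian variety isogenous to a finite product of abelian varieties each without factor of type IV or of
CM type has no factor of type IV, or is of CM type, or is isogenous to `Y × Z` with `Y` without factor of type IV and `Z` of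
CM type** (all three notions are isogeny invariants: `HasNoTypeIVFactor.of_isIsogenous`, `isOfCMType_iff_of_isIsogenous`).
[cite: MoonenZarhin1999LowDim, §7 (proof of Thm. (0.2)) and §3 Thm. (3.2)(2)] [cite: MumfordAV1970, §19 Thm. 1, Cor. 1–2 (pp. 173–174)] -/
theorem hasNoTypeIVFactor_or_isOfCMType_or_exists_isIsogenous_prod_of_isIsogenous {X P : AbelianVariety ℂ}
    (hP : IsProductOf (fun S => HasNoTypeIVFactor S ∨ IsOfCMType S) P) (hXP : IsIsogenous X P) :
    HasNoTypeIVFactor X ∨ IsOfCMType X ∨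
      ∃ Y Z : AbelianVariety ℂ, HasNoTypeIVFactor Y ∧ IsOfCMType Z ∧ IsIsogenous X (Y.prod Z) := by
  rcases hasNoTypeIVFactor_or_isOfCMType_or_exists_isIsogenous_prod hP with h | h | ⟨Y, Z, hY, hZ, h⟩
  · exact Or.inl (h.of_isIsogenous hXP)
  · exact Or.inr (Or.inl ((isOfCMType_iff_of_isIsogenous hXP).2 h))
  · exact Or.inr (Or.inr ⟨Y, Z, hY, hZ, hXP.trans h⟩)

/-- **Positive-dimensional form of the transport**: for `X` isogenous to a finite product of POSITIVE-dimensional abelian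
varieties each without factor of type IV or of CM type: `X` has no factor of type IV, or is of CM type, or `X ∼ Y × Z` with
`Y` without factor of type IV, `Z` of CM type and `0 < dim Y`, `0 < dim Z`. [cite: MoonenZarhin1999LowDim, §7 (proof of Thm. (0.2)) and §3 Thm. (3.2)(2)]
[cite: MumfordAV1970, §19 Thm. 1, Cor. 1–2 (pp. 173–174)] -/
theorem hasNoTypeIVFactor_or_isOfCMType_or_exists_isIsogenous_prod_pos_of_isIsogenous {X P : AbelianVariety ℂ}
    (hP : IsProductOf (fun S => 0 < S.dim ∧ (HasNoTypeIVFactor S ∨ IsOfCMType S)) P) (hXP : IsIsogenous X P) :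
    HasNoTypeIVFactor X ∨ IsOfCMType X ∨
      ∃ Y Z : AbelianVariety ℂ, 0 < Y.dim ∧ 0 < Z.dim ∧ HasNoTypeIVFactor Y ∧ IsOfCMType Z ∧
        IsIsogenous X (Y.prod Z) := by
  rcases (hasNoTypeIVFactor_or_isOfCMType_or_exists_isIsogenous_prod_pos hP).2 with h | h | ⟨Y, Z, hY0, hZ0, hY, hZ, h⟩
  · exact Or.inl (h.of_isIsogenous hXP)
  · exact Or.inr (Or.inl ((isOfCMType_iff_of_isIsogenous hXP).2 h))
  · exact Or.inr (Or.inr ⟨Y, Z, hY0, hZ0, hY, hZ, hXP.trans h⟩)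

end Literature.AlgebraicGeometry.HodgeTheory

end
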